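import Summits.CriticalPhenomena.SAWScalingLimit.Theorems.SAWChargeContinuationAnchorExcursion
import Summits.CriticalPhenomena.SAWScalingLimit.Theorems.SAWLoopFugacityFlowAvoidanceLimitGreenRatioDecomposition
import Summits.CriticalPhenomena.SAWScalingLimit.Theorems.SAWLoopFugacityFlowAvoidanceLimitExcursionRatioWalkSum

/-!
# The window graph of `AnchorExcursion` (stmt-CriticalPhenomena-11196): local agreement with `Ω_δ`
# at the marked points and the two-sided exit decomposition of its Green's-function ratio

Route `SAWChargeContinuation` of `CriticalPhenomena/SAWScalingLimit`, support item `AnchorExcursion`.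
By the landed lattice identity (`tsum_domainSAW_complex_eq`, file `…AnchorExcursionLattice`) the item
reads: along every endpoint approximation `a_δ, b_δ` of the marked points of a Dobrushin domain `D`,
for every hull subdomain `D'` with restriction data `(φ, Φ, d = Φ'_A(0))`,
`G_{W_δ}(a_δ, b_δ)/G_{D_δ}(a_δ, b_δ) → d`, where `D_δ = discreteDomainGraph D δ` and `W_δ` is the
item's WINDOW graph (edges of `D_δ` that are mesh edges of `D'` between mesh points of `D'`;
written inline as the item's `SimpleGraph.fromRel`, no definition is introduced).

The sibling crux `SAWLoopFugacityFlow.AvoidanceLimit` (stmt-CriticalPhenomena-10649, line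
`symplectic-fermion-anchor`, stub S3 `ExcursionRatio`) is the same statement for the CONFINED graph
`confinedGraph D D' δ` (edges of `D_δ` inside `closure D'`, all vertices of `D_δ`); the two graphs
differ exactly at the lattice points lying on `∂D' ∩ D` (`windowGraph_le_confinedGraph`). This file
ports that line's lattice machinery (`greenEntry`, exit kernels) to the window graph:

* §1 `windowGraph_adj_iff_of_ball` / `_of_dist_lt` — inside the agreement balls at `a`, `b` the
  window graph and `D_δ` have the same edges; `greenEntry_window_eq_toReal_rwGreen` — the matrix
  Green's function of the window graph on the volume `meshDomainFinset D δ` is the tree's walk sum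
  `rwGreen`; `greenEntry_window_le_confined` — `G_W ≤ G_{confined}` (so the item's ratio is at most
  the sibling's `greenRatio`);
* §2 `windowRatio_mem_of_sphere` — two-sided first-exit / last-entrance decomposition: the ratio
  `G_W(a,b)/G_{D_δ}(a,b)` is a convex combination of the ratios `G_W(z,y)/G_{D_δ}(z,y)` over pairs of
  the two lattice exit spheres `r ≤ |δz − a| < r + δ`, `r ≤ |δy − b| < r + δ`, so termwise bounds
  transfer (mirror of the sibling's `stub_greenRatioDecomposition`).

The companion file `…AnchorExcursionSphereReduction` turns this into the reduction of the item to
the two printed lattice inputs (uniform discrete boundary Harnack principle at the marked prime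
ends; interior convergence of killed-SRW Green's functions).

Sources: G. F. Lawler, *Intersections of Random Walks* (1991) §1.5 (first-exit / last-entrance
decompositions) [Lawler1991]. Folklore otherwise. No definitions, no named facts.
-/

noncomputable section

open scoped ENNReal Topology ComplexConjugate BigOperators Classical
open Filter Finset Literature.Probability.RandomPlanarGeometry Literature.Probability.LatticeModels
open Summit.CriticalPhenomena.SAWScalingLimit.Theses.SAWChargeContinuation
open Summit.CriticalPhenomena.SAWScalingLimit.Theorems.AvoidanceLimit.Anchor

namespace Summit.CriticalPhenomena.SAWScalingLimit.Theorems.AnchorExcursion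

/-! ## §1 The window graph near the marked points; its Green's function as a walk sum -/

section Window

variable {Ω S : Set ℂ} {δ : ℝ}

/-- Adjacency in the item's window graph, unfolded: an edge of `Ω_δ` that is a mesh edge of `S`
between mesh points of `S` (the defining relation is symmetric). [folklore] -/
theorem windowGraph_adj_iff {x y : Site 2} :
    (SimpleGraph.fromRel fun x y => (discreteDomainGraph Ω δ).Adj x y ∧ (meshGraph S δ).Adj x y ∧
      x ∈ meshVertices S δ ∧ y ∈ meshVertices S δ).Adj x y ↔
      (discreteDomainGraph Ω δ).Adj x y ∧ (meshGraph S δ).Adj x y ∧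
        x ∈ meshVertices S δ ∧ y ∈ meshVertices S δ := by
  rw [SimpleGraph.fromRel_adj]
  constructor
  · rintro ⟨-, h | h⟩
    · exact h
    · exact ⟨h.1.symm, h.2.1.symm, h.2.2.2, h.2.2.1⟩
  · intro h
    exact ⟨h.1.ne, Or.inl h⟩

/-- The window graph is a subgraph of `ℤ²`. [folklore] -/
theorem windowGraph_le_zdGraph (Ω S : Set ℂ) (δ : ℝ) :
    (SimpleGraph.fromRel fun x y => (discreteDomainGraph Ω δ).Adj x y ∧ (meshGraph S δ).Adj x y ∧
      x ∈ meshVertices S δ ∧ y ∈ meshVertices S δ) ≤ zdGraph 2 :=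
  (windowGraph_le Ω S δ).trans ((discreteDomainGraph_le_meshGraph Ω δ).trans (meshGraph_le_zdGraph Ω δ))

/-- **Ball agreement ⇒ the window graph is `Ω_δ` near the marked point.** If
`S ∩ B(p, ε) = Ω ∩ B(p, ε)`, an edge of `Ω_δ` whose closed segment lies in `B(p, ε)` is an edge of
the window graph of `S`: its endpoints are mesh points of `Ω` in the ball, hence of `S`, and its
segment lies in `closure Ω ∩ B ⊆ closure (Ω ∩ B) = closure (S ∩ B) ⊆ closure S`. [folklore] -/
theorem windowGraph_adj_iff_of_ball {p : ℂ} {ε : ℝ}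
    (hball : S ∩ Metric.ball p ε = Ω ∩ Metric.ball p ε) {x y : Site 2}
    (hseg : segment ℝ (meshPoint δ x) (meshPoint δ y) ⊆ Metric.ball p ε) :
    (SimpleGraph.fromRel fun x y => (discreteDomainGraph Ω δ).Adj x y ∧ (meshGraph S δ).Adj x y ∧
      x ∈ meshVertices S δ ∧ y ∈ meshVertices S δ).Adj x y ↔ (discreteDomainGraph Ω δ).Adj x y := by
  refine ⟨fun h => windowGraph_le Ω S δ h, fun h => ?_⟩
  rw [windowGraph_adj_iff]
  obtain ⟨hmesh, hx, hy⟩ := discreteDomainGraph_adj_iff.1 h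
  obtain ⟨hzd, hsegΩ⟩ := meshGraph_adj_iff.1 hmesh
  have hmemS : ∀ z : Site 2, z ∈ meshDomain Ω δ → meshPoint δ z ∈ Metric.ball p ε →
      z ∈ meshVertices S δ := by
    intro z hz hzb
    have hzΩ : meshPoint δ z ∈ Ω := meshDomain_subset_meshVertices Ω δ hz
    have : meshPoint δ z ∈ S ∩ Metric.ball p ε := by rw [hball]; exact ⟨hzΩ, hzb⟩
    exact this.1
  refine ⟨h, meshGraph_adj_iff.2 ⟨hzd, fun z hz => ?_⟩,
    hmemS x hx (hseg (left_mem_segment ℝ _ _)), hmemS y hy (hseg (right_mem_segment ℝ _ _))⟩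
  have hzΩ : z ∈ closure Ω := hsegΩ hz
  have h1 : z ∈ closure (Ω ∩ Metric.ball p ε) := by
    have := Metric.isOpen_ball.inter_closure (s := Metric.ball p ε) (t := Ω) ⟨hseg hz, hzΩ⟩
    rwa [Set.inter_comm] at this
  rw [← hball] at h1
  exact closure_mono Set.inter_subset_left h1

/-- Under ball agreement `S ∩ B(p, ε) = Ω ∩ B(p, ε)` with `r + 2δ ≤ ε`, `δ > 0`, an edge of `Ω_δ` with
one endpoint within `r` of `p` is an edge of the window graph (both endpoints lie in the convex ball
`B(p, ε)`). [folklore] -/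
theorem windowGraph_adj_iff_of_dist_lt {p : ℂ} {ε r : ℝ} (hδ : 0 < δ) (hε : r + 2 * δ ≤ ε)
    (hball : S ∩ Metric.ball p ε = Ω ∩ Metric.ball p ε) {u v : Site 2}
    (hu : dist (meshPoint δ u) p < r) :
    (SimpleGraph.fromRel fun x y => (discreteDomainGraph Ω δ).Adj x y ∧ (meshGraph S δ).Adj x y ∧
      x ∈ meshVertices S δ ∧ y ∈ meshVertices S δ).Adj u v ↔ (discreteDomainGraph Ω δ).Adj u v := by
  refine ⟨fun h => windowGraph_le Ω S δ h, fun h => ?_⟩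
  have hv : dist (meshPoint δ v) p < r + δ := dist_meshPoint_lt_add_of_adj hδ.le hu
    ((discreteDomainGraph_le_meshGraph Ω δ).trans (meshGraph_le_zdGraph Ω δ) h)
  have hu' : meshPoint δ u ∈ Metric.ball p ε := Metric.mem_ball.2 (by linarith)
  have hv' : meshPoint δ v ∈ Metric.ball p ε := Metric.mem_ball.2 (by linarith)
  exact (windowGraph_adj_iff_of_ball hball ((convex_ball p ε).segment_subset hu' hv')).2 h

/-- The window Green's function is at most the domain one (the window graph is a subgraph of
`Ω_δ`). [folklore] -/
theorem greenEntry_window_le (Ω S : Set ℂ) (δ : ℝ) (Λ : Finset (Site 2)) (a b : Site 2) :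
    greenEntry (SimpleGraph.fromRel fun x y => (discreteDomainGraph Ω δ).Adj x y ∧
        (meshGraph S δ).Adj x y ∧ x ∈ meshVertices S δ ∧ y ∈ meshVertices S δ) Λ a b ≤
      greenEntry (discreteDomainGraph Ω δ) Λ a b :=
  greenEntry_mono ((discreteDomainGraph_le_meshGraph Ω δ).trans (meshGraph_le_zdGraph Ω δ))
    (windowGraph_le Ω S δ) Λ a b

/-- **The window Green's function on the volume is the tree's walk sum**: for bounded `Ω`, `δ > 0`
and `a, b ∈ Ω_δ`, `greenEntry W_δ (meshDomainFinset Ω δ) a b = (rwGreen W_δ a b).toReal` (every edge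
of the window graph has its tail in `meshDomain Ω δ`). [folklore] -/
theorem greenEntry_window_eq_toReal_rwGreen (hΩ : Bornology.IsBounded Ω) (hδ : 0 < δ) {a b : Site 2}
    (ha : a ∈ meshDomain Ω δ) (hb : b ∈ meshDomain Ω δ) :
    greenEntry (SimpleGraph.fromRel fun x y => (discreteDomainGraph Ω δ).Adj x y ∧
        (meshGraph S δ).Adj x y ∧ x ∈ meshVertices S δ ∧ y ∈ meshVertices S δ)
        (meshDomainFinset Ω δ) a b =
      (rwGreen (SimpleGraph.fromRel fun x y => (discreteDomainGraph Ω δ).Adj x y ∧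
        (meshGraph S δ).Adj x y ∧ x ∈ meshVertices S δ ∧ y ∈ meshVertices S δ) a b).toReal := by
  have ha' : a ∈ meshDomainFinset Ω δ := by rwa [← Finset.mem_coe, coe_meshDomainFinset hΩ hδ]
  have hb' : b ∈ meshDomainFinset Ω δ := by rwa [← Finset.mem_coe, coe_meshDomainFinset hΩ hδ]
  exact greenEntry_eq_toReal_rwGreen (windowGraph_le_zdGraph Ω S δ)
    (fun x y h => adj_mem_meshDomainFinset hΩ hδ (windowGraph_le Ω S δ h)) ha' hb'

/-- **The window graph is a subgraph of the sibling line's CONFINED graph** `confinedGraph Ω S δ`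
(crux 10649: the edges of `Ω_δ` inside `closure S`, no condition on the vertices); the two differ
exactly at the lattice points lying on `∂S ∩ Ω`. [folklore] -/
theorem windowGraph_le_confinedGraph (Ω S : Set ℂ) (δ : ℝ) :
    (SimpleGraph.fromRel fun x y => (discreteDomainGraph Ω δ).Adj x y ∧ (meshGraph S δ).Adj x y ∧
      x ∈ meshVertices S δ ∧ y ∈ meshVertices S δ) ≤ confinedGraph Ω S δ := by
  intro x y h
  obtain ⟨hD, hS, -, -⟩ := windowGraph_adj_iff.1 h
  rw [confinedGraph, SimpleGraph.fromRel_adj]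
  exact ⟨hD.ne, Or.inl ⟨hD, (meshGraph_adj_iff.1 hS).2⟩⟩

/-- Hence the window Green's function is at most the confined one, and the item's ratio
`G_W(a,b)/G_{Ω_δ}(a,b)` is at most the sibling's `greenRatio Ω S δ a b` pointwise in `δ`: whenever the
sibling stub `ExcursionRatio` gives `greenRatio → d`, the item's ratio has `limsup ≤ d` for free (the
matching lower bound is where the lattice points on `∂D' ∩ D` have to be shown negligible).
[folklore] -/
theorem greenEntry_window_le_confined (Ω S : Set ℂ) (δ : ℝ) (Λ : Finset (Site 2)) (a b : Site 2) :
    greenEntry (SimpleGraph.fromRel fun x y => (discreteDomainGraph Ω δ).Adj x y ∧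
        (meshGraph S δ).Adj x y ∧ x ∈ meshVertices S δ ∧ y ∈ meshVertices S δ) Λ a b ≤
      greenEntry (confinedGraph Ω S δ) Λ a b :=
  greenEntry_mono (confinedGraph_le_zdGraph Ω S δ) (windowGraph_le_confinedGraph Ω S δ) Λ a b

end Window

/-! ## §2 The two-sided first-exit / last-entrance decomposition for the window ratio -/

section Decomposition

/-- **Termwise sphere bounds transfer to the window ratio at the legs.** With `H = Ω_δ`, the window
graph `W` of `S`, the volume `Λ = meshDomainFinset Ω δ`, the lattice balls `B_a = {dist (δ·) pa < r}`,
`B_b` likewise (`dist pa pb ≥ 2r + 2δ`) and ball agreement `S ∩ B(p, ε) = Ω ∩ B(p, ε)` at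
`p = pa, pb` (`r + 2δ ≤ ε`): every walk `a → b` splits at its first exit from `B_a` and its last
entrance into `B_b`, `G_K(a, b) = Σ_{v, w} E_a(v) E_b(w) G_K(v, w)` for BOTH `K = H` and `K = W` with
the SAME nonnegative exit kernels (inside the balls the two graphs have the same edges,
`windowGraph_adj_iff_of_dist_lt`), supported on the exit spheres `r ≤ dist (δv) pa < r + δ`,
`r ≤ dist (δw) pb < r + δ`. Hence `G_W(a, b)/G_H(a, b)` is a convex combination of the sphere-pair
ratios `G_W(v, w)/G_H(v, w)` (pairs with `G_H(v, w) > 0`), and any bound `m ≤ · ≤ M` valid there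
transfers. Mirror, for the window graph, of the sibling line's `stub_greenRatioDecomposition`
(crux 10649). [cite: Lawler1991, §1.5] -/
theorem windowRatio_mem_of_sphere :
    ∀ (Ω S : Set ℂ) (pa pb : ℂ) (ε r δ : ℝ) (a b : Site 2) (m M : ℝ),
      0 < δ → 0 < r → r + 2 * δ ≤ ε →
      S ∩ Metric.ball pa ε = Ω ∩ Metric.ball pa ε → S ∩ Metric.ball pb ε = Ω ∩ Metric.ball pb ε →
      2 * r + 2 * δ ≤ dist pa pb →
      dist (meshPoint δ a) pa < r → dist (meshPoint δ b) pb < r →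
      0 < greenEntry (discreteDomainGraph Ω δ) (meshDomainFinset Ω δ) a b →
      (∀ z y : Site 2, r ≤ dist (meshPoint δ z) pa → dist (meshPoint δ z) pa < r + δ →
        r ≤ dist (meshPoint δ y) pb → dist (meshPoint δ y) pb < r + δ →
        0 < greenEntry (discreteDomainGraph Ω δ) (meshDomainFinset Ω δ) z y →
        m ≤ greenEntry (SimpleGraph.fromRel fun x y => (discreteDomainGraph Ω δ).Adj x y ∧
              (meshGraph S δ).Adj x y ∧ x ∈ meshVertices S δ ∧ y ∈ meshVertices S δ)
              (meshDomainFinset Ω δ) z y /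
            greenEntry (discreteDomainGraph Ω δ) (meshDomainFinset Ω δ) z y ∧
          greenEntry (SimpleGraph.fromRel fun x y => (discreteDomainGraph Ω δ).Adj x y ∧
              (meshGraph S δ).Adj x y ∧ x ∈ meshVertices S δ ∧ y ∈ meshVertices S δ)
              (meshDomainFinset Ω δ) z y /
            greenEntry (discreteDomainGraph Ω δ) (meshDomainFinset Ω δ) z y ≤ M) →
      m ≤ greenEntry (SimpleGraph.fromRel fun x y => (discreteDomainGraph Ω δ).Adj x y ∧
            (meshGraph S δ).Adj x y ∧ x ∈ meshVertices S δ ∧ y ∈ meshVertices S δ)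
            (meshDomainFinset Ω δ) a b /
          greenEntry (discreteDomainGraph Ω δ) (meshDomainFinset Ω δ) a b ∧
        greenEntry (SimpleGraph.fromRel fun x y => (discreteDomainGraph Ω δ).Adj x y ∧
            (meshGraph S δ).Adj x y ∧ x ∈ meshVertices S δ ∧ y ∈ meshVertices S δ)
            (meshDomainFinset Ω δ) a b /
          greenEntry (discreteDomainGraph Ω δ) (meshDomainFinset Ω δ) a b ≤ M := by
  intro Ω S pa pb ε r δ a b m M hδ _hr hε hpa hpb hab ha hb hpos hmM
  set H := discreteDomainGraph Ω δ with hH_def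
  set Hc := (SimpleGraph.fromRel fun x y => (discreteDomainGraph Ω δ).Adj x y ∧
    (meshGraph S δ).Adj x y ∧ x ∈ meshVertices S δ ∧ y ∈ meshVertices S δ) with hHc_def
  set Λ := meshDomainFinset Ω δ with hΛ_def
  have hH : H ≤ zdGraph 2 := (discreteDomainGraph_le_meshGraph Ω δ).trans (meshGraph_le_zdGraph Ω δ)
  have hHc : Hc ≤ H := windowGraph_le Ω S δ
  -- the legs lie in the volume
  have hmem : a ∈ Λ ∧ b ∈ Λ := by
    by_contra h
    exact hpos.ne' (greenEntry_of_not H h)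
  -- the two lattice balls and the restricted graphs `H|_{B_a}`, `H|_{B_b}`
  set Ba : Set (Site 2) := {x | dist (meshPoint δ x) pa < r} with hBa_def
  set Bb : Set (Site 2) := {x | dist (meshPoint δ x) pb < r} with hBb_def
  have haB : a ∈ Ba := ha
  have hbB : b ∈ Bb := hb
  obtain ⟨Ka, hKa⟩ := exists_restrict_adj_iff H Ba
  obtain ⟨Kb, hKb⟩ := exists_restrict_adj_iff H Bb
  have hKaH : Ka ≤ H := fun x y h => ((hKa x y).1 h).1
  have hKbH : Kb ≤ H := fun x y h => ((hKb x y).1 h).1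
  have hBa : ∀ x y, Ka.Adj x y → y ∈ Ba := fun x y h => ((hKa x y).1 h).2.2
  have hBb : ∀ x y, Kb.Adj x y → y ∈ Bb := fun x y h => ((hKb x y).1 h).2.2
  -- local agreement of `W` and `H` near `pa`, `pb`
  have hagree_a : ∀ u v : Site 2, u ∈ Ba → (Hc.Adj u v ↔ H.Adj u v) := fun u v hu =>
    windowGraph_adj_iff_of_dist_lt hδ hε hpa hu
  have hagree_b : ∀ u v : Site 2, u ∈ Bb → (Hc.Adj u v ↔ H.Adj u v) := fun u v hu =>
    windowGraph_adj_iff_of_dist_lt hδ hε hpb hu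
  have hKaHc : Ka ≤ Hc := fun x y h => by
    obtain ⟨hxy, hx, -⟩ := (hKa x y).1 h
    exact (hagree_a x y hx).2 hxy
  have hKbHc : Kb ≤ Hc := fun x y h => by
    obtain ⟨hxy, hx, -⟩ := (hKb x y).1 h
    exact (hagree_b x y hx).2 hxy
  -- `b ∉ B_a` (the balls are `2r + 2δ` apart)
  have hba : b ∉ Ba := by
    intro (h : dist (meshPoint δ b) pa < r)
    have h3 := dist_triangle pa (meshPoint δ b) pb
    rw [dist_comm pa (meshPoint δ b)] at h3
    linarith
  -- the exit kernels of `H` out of the two balls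
  set Ea : Λ → ℝ := fun v => ∑ u : Λ, greenEntry Ka Λ a u *
    (((4 : ℝ)⁻¹ • adjMat H Λ - (4 : ℝ)⁻¹ • adjMat Ka Λ) u v) with hEa_def
  set Eb : Λ → ℝ := fun w => ∑ u : Λ, greenEntry Kb Λ b u *
    (((4 : ℝ)⁻¹ • adjMat H Λ - (4 : ℝ)⁻¹ • adjMat Kb Λ) u w) with hEb_def
  -- their supports: the two exit spheres
  have hEa_sph : ∀ v : Λ, Ea v ≠ 0 →
      r ≤ dist (meshPoint δ v) pa ∧ dist (meshPoint δ v) pa < r + δ := by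
    intro v hv
    obtain ⟨hvB, u, huB, hadj⟩ := exitKernel_ne_zero hH hKa haB hv
    exact ⟨not_lt.1 hvB, dist_meshPoint_lt_add_of_adj hδ.le huB (hH hadj)⟩
  have hEb_sph : ∀ w : Λ, Eb w ≠ 0 →
      r ≤ dist (meshPoint δ w) pb ∧ dist (meshPoint δ w) pb < r + δ := by
    intro w hw
    obtain ⟨hwB, u, huB, hadj⟩ := exitKernel_ne_zero hH hKb hbB hw
    exact ⟨not_lt.1 hwB, dist_meshPoint_lt_add_of_adj hδ.le huB (hH hadj)⟩
  have hEa_not : ∀ v : Λ, Ea v ≠ 0 → (v : Site 2) ∉ Bb := by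
    intro v hv (h : dist (meshPoint δ v) pb < r)
    have h1 := (hEa_sph v hv).2
    have h3 := dist_triangle pa (meshPoint δ v) pb
    rw [dist_comm pa (meshPoint δ (v : Site 2))] at h3
    linarith
  -- the kernels of `W` coincide with those of `H`
  have hKa_zd : Ka ≤ zdGraph 2 := hKaH.trans hH
  have hKb_zd : Kb ≤ zdGraph 2 := hKbH.trans hH
  have hEa_c : ∀ v : Λ, ∑ u : Λ, greenEntry Ka Λ a u *
      (((4 : ℝ)⁻¹ • adjMat Hc Λ - (4 : ℝ)⁻¹ • adjMat Ka Λ) u v) = Ea v := by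
    intro v
    refine exitKernel_congr (fun u v' hu => hagree_a u v' ?_) v
    by_contra h
    exact hu (greenEntry_eq_zero_of_not_mem hKa_zd hBa Λ haB h)
  have hEb_c : ∀ w : Λ, ∑ u : Λ, greenEntry Kb Λ b u *
      (((4 : ℝ)⁻¹ • adjMat Hc Λ - (4 : ℝ)⁻¹ • adjMat Kb Λ) u w) = Eb w := by
    intro w
    refine exitKernel_congr (fun u w' hu => hagree_b u w' ?_) w
    by_contra h
    exact hu (greenEntry_eq_zero_of_not_mem hKb_zd hBb Λ hbB h)
  -- the two-sided decompositions of `G_H(a, b)` and `G_W(a, b)`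
  have hG : greenEntry H Λ a b = ∑ v : Λ, ∑ w : Λ, Ea v * Eb w * greenEntry H Λ v w :=
    greenEntry_eq_sum_sum_exitKernel hH hKaH hKbH hBa hBb hmem.1 hmem.2 haB hbB hba Ea Eb
      (fun _ => rfl) (fun _ => rfl) hEa_not
  have hGc : greenEntry Hc Λ a b = ∑ v : Λ, ∑ w : Λ, Ea v * Eb w * greenEntry Hc Λ v w :=
    greenEntry_eq_sum_sum_exitKernel (hHc.trans hH) hKaHc hKbHc hBa hBb hmem.1 hmem.2 haB hbB hba
      Ea Eb hEa_c hEb_c hEa_not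
  -- transfer the termwise bounds
  rw [hG, hGc]
  refine div_sum_sum_mem_of_termwise Ea Eb (fun v w => greenEntry H Λ v w)
    (fun v w => greenEntry Hc Λ v w) m M (fun v => exitKernel_nonneg hH hKaH Λ a v)
    (fun w => exitKernel_nonneg hH hKbH Λ b w)
    (fun v w => greenEntry_nonneg (hHc.trans hH) Λ v w)
    (fun v w => greenEntry_window_le Ω S δ Λ v w) (by rwa [hG] at hpos) ?_
  intro v w hv hw hGvw
  obtain ⟨h1, h2⟩ := hEa_sph v hv
  obtain ⟨h3, h4⟩ := hEb_sph w hw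
  exact hmM v w h1 h2 h3 h4 hGvw

end Decomposition

end Summit.CriticalPhenomena.SAWScalingLimit.Theorems.AnchorExcursion

end
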